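import Literature.AlgebraicGeometry.HodgeTheory.CorrespondenceActionHodgeClassesOfGysinResolved
import Literature.AlgebraicGeometry.HodgeTheory.GysinFormalismCorrespondences
import Literature.AlgebraicGeometry.HodgeTheory.GysinKernelProofs
import Literature.AlgebraicGeometry.HodgeTheory.SupportedClassesSemipurity
import Literature.AlgebraicGeometry.HodgeTheory.SupportedHodgeClassDescent
import Literature.AlgebraicGeometry.Resolution.ProjectiveResolutionProofs
import Literature.AlgebraicTopology.SingularHomology.HomologyRingChange
import HarnessLib

/-!
# The cycle class through desingularisations: `[Z] = Σ nᵢ τᵢ_* 1` (Voisin I §11.1.4), real definition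

Family `hodge`, layer `Literature/AlgebraicGeometry/HodgeTheory`. The hypothesis structure
`GysinFormalism` (`HodgeTheory/GysinFormalism`) records Gysin morphisms AND cycle classes
`cl : Z_d(X) → H^{2e}(X(ℂ); ℂ)` with their printed properties; its Gysin half is CONSTRUCTED in
`HodgeTheory/ComplexGysin` (`complexGysin μ = PD⁻¹ ∘ f(ℂ)_* ∘ PD` for an orientation family `μ`).
This file constructs the cycle-class half AS DATA, following C. Voisin, *Hodge Theory and Complex
Algebraic Geometry I* (2002), §11.1.4 verbatim: "Let `τ : Z̃ → X` be a desingularization of `Z`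
[…] We can then define the class `[Z] ∈ H^{2r}(X, ℤ)`, where `dim X = n + r`, as `τ_*(1_{Z̃})`",
extended additively to cycles `Z = Σ nᵢ Zᵢ` ("we set `[Z] = Σ nᵢ [Zᵢ]`", Voisin II §9.2.2).

* `ResolutionFamily X d` — a choice, for every point `z` of `X` of dimension `d` (i.e. for every
  `d`-dimensional closed subvariety `closure {z}`), of a smooth projective `d`-fold `V_z` and a
  morphism `τ_z : V_z ⟶ X` pushing the fundamental cycle of `V_z` forward to the prime cycle
  `[closure {z}]` (`deg (V_z / closure {z}) = 1`: a desingularisation of `closure {z}` followed by the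
  inclusion). For `X` smooth projective such families EXIST (`nonempty_resolutionFamily`) by
  projective Hironaka, a THEOREM of the tree (`Resolution.Hironaka1964_projective_holds`, through
  `exists_resolution_primeCycle`).
* `primeClass μ hX hde ρ z = τ_z* 1 ∈ H^{2e}(X(ℂ); ℂ)` (`d + e = dim X`; `0` on points of dimension
  `≠ d`) and the additive **cycle class** `cycleClass μ hX hde ρ : Z_d(X) →+ H^{2e}(X(ℂ); ℂ)`,
  `Z ↦ Σ_z Z(z) • τ_z* 1` (a finite sum: cycles on the Noetherian `X` have finite support).
* PROVED here, for EVERY orientation family `μ` and every resolution family `ρ`: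
  `cycleClass_primeCycle_eq` (`[closure {z}] = τ_z* 1`), `cycleClass_eq_sum`, and
  `cycleClass_restrictCompl_eq_zero` (**support**: `[Z]` dies off any Zariski-closed set containing
  the support of `Z` — the field `cl_restrictCompl_eq_zero` of `GysinFormalism` — from the support
  property of the Gysin maps, `complexGysin_restrictCompl_eq_zero` with the tree's theorem
  `gysinMap_restrictCompl_eq_zero_of_field ℂ`).
* Three classical properties hold for the complex orientations only and are recorded as hypothesis
  PREDICATES on `μ` (D-0014; nothing is asserted): `OrientationFamily.HasDegreeFormula` (Fulton,
  Lemma 19.1.2: `g_* 1_V = deg(V/W) • τ_* 1_{W̃}`), `OrientationFamily.CycleClassDivEqZero` (Voisin II,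
  Lemma 9.18 in generator form: `[div φ] = 0`) and `OrientationFamily.HasRationalFundamentalClasses`
  (`[X(ℂ)]_μ` is a complexified rational fundamental class). Their consequences — independence of
  `ρ`, `[ι(V)] = ι_* 1` for smooth `V`, `cl ∘ f_* = f_* ∘ cl` (Prop. 9.21 (ii)), `cl_congr`, and the
  resulting `GysinFormalism` with its Hodge compatibility — are `HodgeTheory/CycleClassPushforward` and
  `HodgeTheory/GysinFormalismOfResolutions`.

## References

* [VoisinHodgeI2002] C. Voisin, Hodge Theory and Complex Algebraic Geometry I, CUP 2002, §11.1.2, §11.1.4.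
* [VoisinHodgeII2003] C. Voisin, Hodge Theory and Complex Algebraic Geometry II, CUP 2003, §9.2.2,
  proof of Lemma 9.18.
* [Fulton1998] W. Fulton, Intersection Theory, 2nd ed. 1998, §1.3–1.4, §19.1.
* [Kollar2007] J. Kollár, Lectures on Resolution of Singularities, PUP 2007, Thm. 3.27.
* [GrothendieckTopology1969] A. Grothendieck, Hodge's general conjecture is false for trivial
  reasons, Topology 8 (1969), §1.
-/

noncomputable section

open CategoryTheory AlgebraicGeometry Order
open Literature.AlgebraicTopology.SingularHomology

namespace Literature.AlgebraicGeometry.HodgeTheory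

section HodgeTheory

variable {n : ℕ} {X : Motives.SchemeOver ℂ}

/-! ### Resolution families -/

/-- A **resolution family** in dimension `d` on `X`: for every point `z` of `X` with
`dim closure {z} = d` a smooth projective `d`-fold `V z`, a quasi-compact morphism
`hom z : V z ⟶ X` and a generic point `gen z` of `V z` with
`(hom z)_* [closure {gen z}] = [closure {z}]` for Mathlib's weighted push-forward of cycles — i.e.
`hom z` maps `V z` birationally onto `closure {z}` ("let `τ : Z̃ → X` be a desingularization of
`Z`"; `deg(Z̃/Z) = 1`, Fulton §1.4). [cite: VoisinHodgeI2002, §11.1.4] [cite: Fulton1998, §1.4] -/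
structure ResolutionFamily (X : Motives.SchemeOver ℂ) (d : ℕ) : Type 1 where
  /-- The smooth projective model of `closure {z}`. -/
  V : {z : X.left // Order.height z = (d : ℕ∞)} → Motives.SchemeOver ℂ
  /-- `V z` is smooth projective of dimension `d`. -/
  smooth : ∀ z, Motives.IsSmoothProjective d (V z)
  /-- The morphism `τ_z : V z ⟶ X` (desingularisation followed by the inclusion). -/
  hom : ∀ z, V z ⟶ X
  /-- `τ_z` is quasi-compact (so that push-forward of cycles along it makes sense). -/
  quasiCompact : ∀ z, QuasiCompact (hom z).left
  /-- A generic point of `V z`. -/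
  gen : ∀ z, (V z).left
  /-- `gen z` is the generic point of `V z`. -/
  isGenericPoint_gen : ∀ z, IsGenericPoint (gen z) Set.univ
  /-- `τ_z* [V z] = [closure {z}]`: `τ_z` maps `gen z` to `z` with trivial residue field extension. -/
  map_primeCycle : ∀ z, AlgebraicCycle.map (hom z).left Order.height Order.height
    (Motives.primeCycle (gen z)) = Motives.primeCycle z.1

namespace ResolutionFamily

attribute [instance] ResolutionFamily.quasiCompact

variable {d : ℕ} (ρ : ResolutionFamily X d)

/-- `τ_z` maps the generic point of `V z` to `z` (read off `τ_z* [V z] = [closure {z}]` at `z`).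
[cite: Fulton1998, §1.4] -/
theorem base_gen (z : {z : X.left // Order.height z = (d : ℕ∞)}) :
    (ρ.hom z).left.base (ρ.gen z) = z.1 := by
  classical
  have h := congrArg (fun c : AlgebraicCycle X.left ℤ ↦ c z.1) (ρ.map_primeCycle z)
  simp only [Motives.primeCycle_apply_self] at h
  rw [Motives.algebraicCycleMap_primeCycle_eq_nsmul] at h
  by_contra hne
  rw [Function.locallyFinsuppWithin.coe_nsmul, Pi.smul_apply,
    Motives.primeCycle_apply_of_ne (Ne.symm hne), smul_zero] at h
  exact zero_ne_one h

/-- Every point of `V z` maps into `closure {z}` (it specialises from the generic point, which maps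
to `z`). [folklore] -/
theorem base_mem_closure (z : {z : X.left // Order.height z = (d : ℕ∞)}) (v : (ρ.V z).left) :
    (ρ.hom z).left.base v ∈ closure ({z.1} : Set X.left) := by
  have h := ((ρ.isGenericPoint_gen z).specializes (Set.mem_univ v)).map
    (ρ.hom z).left.base.hom.continuous
  rw [ρ.base_gen z] at h
  exact specializes_iff_mem_closure.1 h

end ResolutionFamily

/-- **Resolution families exist on a smooth projective variety**, in every dimension `d`: resolve
`closure {z}` with its reduced structure by projective Hironaka (Kollár Thm. 3.27, the tree's theorem
`Resolution.Hironaka1964_projective_holds`) and compose with the closed immersion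
(`exists_resolution_primeCycle`); morphisms between smooth projective varieties are proper, hence
quasi-compact. [cite: Kollar2007, Thm. 3.27] [cite: VoisinHodgeI2002, §11.1.4] -/
theorem nonempty_resolutionFamily (hX : Motives.IsSmoothProjective n X) (d : ℕ) :
    Nonempty (ResolutionFamily X d) := by
  have H : ∀ z : {z : X.left // Order.height z = (d : ℕ∞)},
      ∃ (V : Motives.SchemeOver ℂ) (τ : V ⟶ X) (η : V.left) (hV : Motives.IsSmoothProjective d V)
        (_ : QuasiCompact τ.left), IsGenericPoint η Set.univ ∧
        AlgebraicCycle.map τ.left Order.height Order.height (Motives.primeCycle η) =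
          Motives.primeCycle z.1 := by
    intro z
    obtain ⟨V, τ, η, hV, hη, -, hmap⟩ :=
      exists_resolution_primeCycle Resolution.Hironaka1964_projective_holds hX z.1 z.2
    haveI : QuasiCompact τ.left :=
      haveI := isProper_left_of_isSmoothProjective hV hX τ
      inferInstance
    exact ⟨V, τ, η, hV, this, hη, hmap⟩
  choose V τ η hV hqc hη hmap using H
  exact ⟨⟨V, hV, τ, hqc, η, hη, fun z ↦ by convert hmap z⟩⟩

/-! ### The class of a prime cycle and the cycle class -/

open Classical in
/-- **The class of the prime cycle `[closure {z}]`** through the resolution family `ρ`: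
`τ_z* 1_{V z} ∈ H^{2e}(X(ℂ); ℂ)` (`d + e = dim X`; the Gysin morphism is the tree's `complexGysin μ`),
and `0` at points of dimension `≠ d` ("define the class `[Z]` … as `τ_*(1_{Z̃})`").
[cite: VoisinHodgeI2002, §11.1.4] -/
def primeClass (μ : OrientationFamily) (hX : Motives.IsSmoothProjective n X) {d e : ℕ}
    (hde : d + e = n) (ρ : ResolutionFamily X d) (z : X.left) : complexBetti X (2 * e) :=
  if hz : Order.height z = (d : ℕ∞) then
    complexGysin μ (ρ.smooth ⟨z, hz⟩) hX (ρ.hom ⟨z, hz⟩) (show 0 + 2 * n = 2 * e + 2 * d by omega)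
      (singularCohomology.one ℂ (Motives.ComplexPoints (ρ.V ⟨z, hz⟩)))
  else 0

/-- Unfolding `primeClass` at a point of dimension `d`. [cite: VoisinHodgeI2002, §11.1.4] -/
theorem primeClass_of_height_eq (μ : OrientationFamily) (hX : Motives.IsSmoothProjective n X)
    {d e : ℕ} (hde : d + e = n) (ρ : ResolutionFamily X d) {z : X.left}
    (hz : Order.height z = (d : ℕ∞)) :
    primeClass μ hX hde ρ z =
      complexGysin μ (ρ.smooth ⟨z, hz⟩) hX (ρ.hom ⟨z, hz⟩) (show 0 + 2 * n = 2 * e + 2 * d by omega)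
        (singularCohomology.one ℂ (Motives.ComplexPoints (ρ.V ⟨z, hz⟩))) := by
  classical
  unfold primeClass
  rw [dif_pos hz]

/-- `primeClass` vanishes at points of dimension `≠ d`. [cite: VoisinHodgeI2002, §11.1.4] -/
theorem primeClass_of_height_ne (μ : OrientationFamily) (hX : Motives.IsSmoothProjective n X)
    {d e : ℕ} (hde : d + e = n) (ρ : ResolutionFamily X d) {z : X.left}
    (hz : Order.height z ≠ (d : ℕ∞)) : primeClass μ hX hde ρ z = 0 := by
  classical
  unfold primeClass
  rw [dif_neg hz]

/-- The summands `Z(z) • τ_z* 1` have finite support. [folklore] -/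
theorem finite_support_smul_primeClass (μ : OrientationFamily) (hX : Motives.IsSmoothProjective n X)
    {d e : ℕ} (hde : d + e = n) (ρ : ResolutionFamily X d) (Z : AlgebraicCycle X.left ℤ) :
    (Function.support fun z ↦ ((Z z : ℤ) : ℂ) • primeClass μ hX hde ρ z).Finite :=
  (finite_support_of_isSmoothProjective hX Z).subset fun z hz h ↦ hz (by simp [h])

/-- **The cycle class** `Z ↦ [Z] = Σ_z Z(z) • τ_z* 1_{V z} : Z_d(X) →+ H^{2e}(X(ℂ); ℂ)` (`d + e = dim X`)
through the resolution family `ρ`, relative to the orientation family `μ` ("we set `[Z] = Σ nᵢ [Zᵢ]`",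
with `[Zᵢ] = τ_*(1_{Z̃ᵢ})`). [cite: VoisinHodgeI2002, §11.1.4] [cite: VoisinHodgeII2003, §9.2.2] -/
def cycleClass (μ : OrientationFamily) (hX : Motives.IsSmoothProjective n X) {d e : ℕ}
    (hde : d + e = n) (ρ : ResolutionFamily X d) :
    ↥(Motives.cyclesOfDim X.left d) →+ complexBetti X (2 * e) where
  toFun Z := ∑ᶠ z, (((Z : AlgebraicCycle X.left ℤ) z : ℤ) : ℂ) • primeClass μ hX hde ρ z
  map_zero' := by simp
  map_add' Z Z' := by
    rw [← finsum_add_distrib (finite_support_smul_primeClass μ hX hde ρ Z)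
      (finite_support_smul_primeClass μ hX hde ρ Z')]
    refine finsum_congr fun z ↦ ?_
    rw [AddSubgroup.coe_add, Function.locallyFinsuppWithin.coe_add, Pi.add_apply, Int.cast_add,
      add_smul]

/-- Unfolding `cycleClass`. [cite: VoisinHodgeI2002, §11.1.4] -/
theorem cycleClass_apply (μ : OrientationFamily) (hX : Motives.IsSmoothProjective n X) {d e : ℕ}
    (hde : d + e = n) (ρ : ResolutionFamily X d) (Z : ↥(Motives.cyclesOfDim X.left d)) :
    cycleClass μ hX hde ρ Z =
      ∑ᶠ z, (((Z : AlgebraicCycle X.left ℤ) z : ℤ) : ℂ) • primeClass μ hX hde ρ z :=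
  rfl

/-- `cycleClass` as a finite sum over any finite set containing the support. [folklore] -/
theorem cycleClass_eq_sum (μ : OrientationFamily) (hX : Motives.IsSmoothProjective n X) {d e : ℕ}
    (hde : d + e = n) (ρ : ResolutionFamily X d) (Z : ↥(Motives.cyclesOfDim X.left d))
    {s : Finset X.left} (hs : Function.support (Z : AlgebraicCycle X.left ℤ) ⊆ s) :
    cycleClass μ hX hde ρ Z =
      ∑ z ∈ s, (((Z : AlgebraicCycle X.left ℤ) z : ℤ) : ℂ) • primeClass μ hX hde ρ z := by
  rw [cycleClass_apply]
  exact finsum_eq_sum_of_support_subset _ fun z hz ↦ hs fun h ↦ hz (by simp [h])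

/-- **`[closure {z}] = τ_z* 1`**: the cycle class of the prime cycle of a point `z` of dimension `d` is
the Gysin image of `1` along the chosen model `τ_z : V z ⟶ X`. [cite: VoisinHodgeI2002, §11.1.4] -/
theorem cycleClass_primeCycle_eq (μ : OrientationFamily) (hX : Motives.IsSmoothProjective n X)
    {d e : ℕ} (hde : d + e = n) (ρ : ResolutionFamily X d) (z : X.left)
    (hz : Order.height z = (d : ℕ∞))
    (hmem : Motives.primeCycle z ∈ Motives.cyclesOfDim X.left d) :
    cycleClass μ hX hde ρ ⟨Motives.primeCycle z, hmem⟩ =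
      complexGysin μ (ρ.smooth ⟨z, hz⟩) hX (ρ.hom ⟨z, hz⟩) (show 0 + 2 * n = 2 * e + 2 * d by omega)
        (singularCohomology.one ℂ (Motives.ComplexPoints (ρ.V ⟨z, hz⟩))) := by
  rw [cycleClass_apply, finsum_eq_single _ z fun z' hz' ↦ by
    rw [Motives.primeCycle_apply_of_ne hz', Int.cast_zero, zero_smul]]
  rw [Motives.primeCycle_apply_self, Int.cast_one, one_smul, primeClass_of_height_eq μ hX hde ρ hz]

/-! ### Support -/

/-- **A Gysin image of `1` is supported on the closure of the image of the generic point**: for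
`g : V ⟶ X` between smooth projective varieties with `V` irreducible of generic point `η`,
`g_* 1` restricts to `0` on `(X ∖ S)(ℂ)` for every Zariski-closed `S ∋ g η` (all of `V` maps into
`closure {g η} ⊆ S`, so `1_V` dies on the empty `(V ∖ g⁻¹S)(ℂ)`; then
`complexGysin_restrictCompl_eq_zero`). [cite: VoisinHodgeII2003, proof of Lemma 9.18]
[cite: FultonYoungTableaux1997, Appendix B §B.2 Exercise 5] -/
theorem complexGysin_one_restrictCompl_eq_zero (μ : OrientationFamily) {d : ℕ}
    {V : Motives.SchemeOver ℂ} (hV : Motives.IsSmoothProjective d V)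
    (hX : Motives.IsSmoothProjective n X) (g : V ⟶ X) {e : ℕ} (h : 0 + 2 * n = 2 * e + 2 * d)
    {η : V.left} (hη : IsGenericPoint η Set.univ) {S : Set X.left} (hS : IsClosed S)
    (hηS : g.left.base η ∈ S) :
    complexBetti.restrictCompl X S (2 * e)
      (complexGysin μ hV hX g h (singularCohomology.one ℂ (Motives.ComplexPoints V))) = 0 := by
  refine complexGysin_restrictCompl_eq_zero (gysinMap_restrictCompl_eq_zero_of_field ℂ) μ
    (OrientationFamily.hasPoincareDuality μ) hV hX g h hS _ ?_
  have hpre : g.left.base ⁻¹' S = Set.univ := by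
    refine Set.eq_univ_of_forall fun v ↦ ?_
    have hv : g.left.base η ⤳ g.left.base v :=
      (hη.specializes (Set.mem_univ v)).map g.left.base.hom.continuous
    exact hv.mem_closed hS hηS
  haveI : IsEmpty (Motives.complexPointsCompl V (g.left.base ⁻¹' S)) :=
    ⟨fun P ↦ P.2 (Set.eq_univ_iff_forall.1 hpre _)⟩
  haveI := ModuleCat.subsingleton_of_isZero
    (Motives.isZero_singularCohomology_of_isEmpty ℂ ℂ
      (E := Motives.complexPointsCompl V (g.left.base ⁻¹' S)) 0)
  exact Subsingleton.elim _ _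

/-- `τ_z* 1` dies off every Zariski-closed `S ∋ z`. [cite: VoisinHodgeII2003, proof of Lemma 9.18] -/
theorem primeClass_restrictCompl_eq_zero (μ : OrientationFamily) (hX : Motives.IsSmoothProjective n X)
    {d e : ℕ} (hde : d + e = n) (ρ : ResolutionFamily X d) {z : X.left} {S : Set X.left}
    (hS : IsClosed S) (hz : z ∈ S) :
    complexBetti.restrictCompl X S (2 * e) (primeClass μ hX hde ρ z) = 0 := by
  by_cases h : Order.height z = (d : ℕ∞)
  · rw [primeClass_of_height_eq μ hX hde ρ h]
    exact complexGysin_one_restrictCompl_eq_zero μ (ρ.smooth ⟨z, h⟩) hX (ρ.hom ⟨z, h⟩) _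
      (ρ.isGenericPoint_gen ⟨z, h⟩) hS (by rw [ρ.base_gen ⟨z, h⟩]; exact hz)
  · rw [primeClass_of_height_ne μ hX hde ρ h, map_zero]

/-- **Support of the cycle class** (the field `cl_restrictCompl_eq_zero` of `GysinFormalism` for
`cycleClass`): if every point `z` with `Z(z) ≠ 0` lies in the Zariski-closed `S`, then `[Z]`
restricts to `0` on `(X ∖ S)(ℂ)` ("by construction, the class `[Z]` of a cycle `Z` of `X̄` vanishes
on `X̄ – Supp Z`"). [cite: VoisinHodgeII2003, proof of Lemma 9.18] -/
theorem cycleClass_restrictCompl_eq_zero (μ : OrientationFamily) (hX : Motives.IsSmoothProjective n X)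
    {d e : ℕ} (hde : d + e = n) (ρ : ResolutionFamily X d) (Z : ↥(Motives.cyclesOfDim X.left d))
    {S : Set X.left} (hS : IsClosed S) (hZ : ∀ z, (Z : AlgebraicCycle X.left ℤ) z ≠ 0 → z ∈ S) :
    complexBetti.restrictCompl X S (2 * e) (cycleClass μ hX hde ρ Z) = 0 := by
  rw [cycleClass_eq_sum μ hX hde ρ Z (s := (finite_support_of_isSmoothProjective hX Z).toFinset)
    (by simp), map_sum]
  refine Finset.sum_eq_zero fun z hz ↦ ?_
  rw [map_smul, primeClass_restrictCompl_eq_zero μ hX hde ρ hS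
    (hZ z (by simpa using hz)), smul_zero]

/-! ### Three hypotheses on the orientation family

The cycle class is defined for EVERY orientation family `μ`; three of its classical properties hold
for the complex orientations only. They are recorded here as hypothesis PREDICATES on `μ` (D-0014: no
existence is asserted; `HodgeTheory/ComplexOrientationFamily` pins the family and states the named
facts), consumed by `HodgeTheory/CycleClassPushforward` and `HodgeTheory/GysinFormalismOfResolutions`. -/

/-- **The degree formula** for the Gysin morphisms `complexGysin μ` of the orientation family `μ`
(Fulton, Lemma 19.1.2 "`f_* cl(V) = deg(V/W) · cl(W)`", pushed into a smooth projective ambient and read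
through a desingularisation of `W`; hypothesis predicate): for `X` smooth projective of dimension
`n = d + e`, `g : V ⟶ X` and `τ : W̃ ⟶ X` from smooth projective `d`-folds with generic points `η`, `ω`,
and `z ∈ X`, `k ≥ 1` with `g_*[closure {η}] = k • [closure {z}]` and `τ_*[closure {ω}] = [closure {z}]`
(weighted push-forward of cycles: `k = [K(V) : K(closure {z})]`, `W̃` birational onto `closure {z}`),
`g_* 1_V = k • τ_* 1_{W̃}` in `H^{2e}(X(ℂ); ℂ)`. True for the complex orientation family; it fails for
general `μ`. [cite: Fulton1998, Lemma 19.1.2 and §19.1] [cite: VoisinHodgeI2002, §11.1.4] -/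
def OrientationFamily.HasDegreeFormula (μ : OrientationFamily) : Prop :=
  ∀ ⦃n d e : ℕ⦄ ⦃X V W : Motives.SchemeOver ℂ⦄ (hX : Motives.IsSmoothProjective n X)
    (hV : Motives.IsSmoothProjective d V) (hW : Motives.IsSmoothProjective d W) (hde : d + e = n)
    (g : V ⟶ X) (τ : W ⟶ X) [QuasiCompact g.left] [QuasiCompact τ.left] ⦃η : V.left⦄ ⦃ω : W.left⦄,
    IsGenericPoint η Set.univ → IsGenericPoint ω Set.univ → ∀ ⦃z : X.left⦄ ⦃k : ℕ⦄, 0 < k →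
    AlgebraicCycle.map g.left height height (Motives.primeCycle η) = k • Motives.primeCycle z →
    AlgebraicCycle.map τ.left height height (Motives.primeCycle ω) = Motives.primeCycle z →
      complexGysin μ hV hX g (show 0 + 2 * n = 2 * e + 2 * d by omega)
          (singularCohomology.one ℂ (Motives.ComplexPoints V)) =
        (k : ℂ) • complexGysin μ hW hX τ (show 0 + 2 * n = 2 * e + 2 * d by omega)
          (singularCohomology.one ℂ (Motives.ComplexPoints W))

/-- **Lemma 9.18 in generator form** for the cycle class through desingularisations relative to the
orientation family `μ` (hypothesis predicate on `μ`): for `X` smooth projective of dimension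
`n = d + e`, every resolution family `ρ`, every closed subvariety `W ⊆ X` of dimension `d + 1` and
every `φ ∈ K(W)`, `φ ≠ 0`, the `d`-cycle `div φ` (Fulton §1.3; coefficients `W.divFun φ`) has cycle
class `[div φ] = Σ_P ord_P(φ) • τ_P* 1 = 0` in `H^{2e}(X(ℂ); ℂ)` ("If `Z` is rationally equivalent to
`0`, then `[Z] = 0`"; `Rat_d X` is generated by such `div φ`). True for the complex orientation family
(Voisin's proof: desingularise `W`, Prop. 9.21 (ii), and `[div φ̃] = c₁(𝒪(div φ̃)) = 0`); false for a
general `μ`. [cite: VoisinHodgeII2003, Lemma 9.18] [cite: Fulton1998, §1.3] -/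
def OrientationFamily.CycleClassDivEqZero (μ : OrientationFamily) : Prop :=
  ∀ ⦃n d e : ℕ⦄ ⦃X : Motives.SchemeOver ℂ⦄ (hX : Motives.IsSmoothProjective n X) (hde : d + e = n)
    (ρ : ResolutionFamily X d) (W : Motives.ClosedSubvariety X.left) [IsLocallyNoetherian W.carrier]
    (φ : W.carrier.functionField), φ ≠ 0 → W.dim = d + 1 →
    ∀ ⦃c : AlgebraicCycle X.left ℤ⦄ (hc : c ∈ Motives.cyclesOfDim X.left d), ⇑c = W.divFun φ →
      cycleClass μ hX hde ρ ⟨c, hc⟩ = 0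

/-- **The orientation family has rational fundamental classes** (hypothesis predicate): for every
smooth projective `X` of dimension `n`, `[X(ℂ)]_μ ∈ H_{2n}(X(ℂ); ℂ)` is the complexification
`ι_*[X(ℂ)]_ν` of the fundamental class of some `ℚ`-orientation `ν` of `X(ℂ)` (as for the complex
orientations, defined over `ℤ`). [cite: VoisinHodgeI2002, §7.3.2] [cite: HatcherAT2002, §3.3 p. 235] -/
def OrientationFamily.HasRationalFundamentalClasses (μ : OrientationFamily) : Prop :=
  ∀ ⦃n : ℕ⦄ ⦃X : Motives.SchemeOver ℂ⦄ (hX : Motives.IsSmoothProjective n X),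
    ∃ ν : HomologicalOrientation ℚ (Motives.ComplexPoints X) (2 * n),
      singularHomology.coeffChange (Motives.ComplexPoints X) (algebraMap ℚ ℂ).toAddMonoidHom (2 * n)
        ν.fundamentalClass = (μ hX).fundamentalClass

end HodgeTheory

end Literature.AlgebraicGeometry.HodgeTheory

end
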